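import Literature.Probability.Percolation.RussoFormula
import HarnessLib

/-!
# The multi-valued map principle (Duminil-Copin–Sidoravicius–Tassion 2016, Lemma 7)

Topic: `Literature/Probability/Percolation`. Part of the bottom-up decomposition of the named
fact `DuminilCopinSidoraviciusTassion2016` (`HalfSpace.lean`; DST 2016, Thm. 1, no percolation
at criticality on slabs): the counting lemma behind the gluing Lemma 6 of the paper (§2.3),
PROVED here in its finite form.

**DST 2016, Lemma 7** (p. 6). Let `s, t > 0`. Consider two events `𝒜`, `ℬ` and a map `Φ` from
`𝒜` into the set of subevents of `ℬ`, such that (i) `|Φ(ω)| ≥ t` for all `ω ∈ 𝒜`, and (ii) for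
every `ω' ∈ ℬ` there is a set `S` of at most `s` edges such that every `ω` with `ω' ∈ Φ(ω)`
agrees with `ω'` off `S`. Then `P_p[𝒜] ≤ (2 / min{p, 1-p})^s / t · P_p[ℬ]`. *Proof* (printed,
eqs. (14)–(16)): exchange the summations over `ω` and `ω' ∈ Φ(ω)`; a configuration agreeing
with `ω'` off `S` has weight at most `P[ω'] / min{p,1-p}^s`, and at most `2^s` configurations
agree with `ω'` off `S`.

The printed proof sums `P[ω]` over single configurations, i.e. it takes place on a finite
product space `{0,1}^E`. Accordingly the lemma is formalised for a finite coordinate type `ι`,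
configurations `ω : Finset ι`, and the Bernoulli weight
`cfgWeight p ω = ∏ᵢ (p if i ∈ ω else 1 - p)`:

* `DST2016_lemma7` — PROVED, the weighted-sum form
  `Σ_{ω ∈ 𝒜} w(ω) ≤ (2 / min{p,1-p})^s / t · Σ_{ω' ∈ ℬ} w(ω')` for `0 < p < 1`;
* `DST2016_lemma7_setBernoulli` — PROVED, the same for the product Bernoulli measure
  `setBer(univ, p)` on `Set ι` (Mathlib's `ProbabilityTheory.setBernoulli`; the bond percolation
  measure of a finite graph all of whose pairs are edges is the case `ι = Sym2 V`), via
  `setBernoulli_real_image_coe : setBer(univ, p) (𝒜) = Σ_{ω ∈ 𝒜} w(ω)`.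

Hypothesis (ii) is taken with `|S| ≤ s` ("less than `s` edges" in the paper; the weak
inequality gives the formally stronger statement, with the same proof), and `t` is any positive
real.

## Sources

* H. Duminil-Copin, V. Sidoravicius, V. Tassion, *Absence of infinite cluster for critical
  Bernoulli percolation on slabs*, Comm. Pure Appl. Math. 69 (2016), 1397–1411,
  arXiv:1401.7130: Lemma 7 and its proof, eqs. (14)–(16) (p. 6).
* L. Russo, Z. Wahrsch. Verw. Gebiete 56 (1981), §4 (cylinder probabilities as products of
  one-coordinate weights; `Russo.setBernoulli_real_localCylinder` of `RussoFormula.lean`).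
-/

noncomputable section

namespace Literature.Probability.Percolation

open MeasureTheory ProbabilityTheory Finset LatticeModels
open scoped ProbabilityTheory

variable {ι : Type*} [Fintype ι] [DecidableEq ι]

/-! ## Bernoulli weights of single configurations -/

/-- The Bernoulli(`p`) weight of the configuration `ω ⊆ ι` (open coordinates `ω`):
`P_p[ω] = ∏ᵢ (p if i ∈ ω else 1 - p) = p^{|ω|} (1-p)^{|ι∖ω|}`.
[cite: DuminilCopinSidoraviciusTassion2016, Lemma 7 (proof, P_p[ω])] -/
def cfgWeight (p : ℝ) (ω : Finset ι) : ℝ := ∏ i, if i ∈ ω then p else 1 - p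

/-- Bernoulli weights are nonnegative for `p ∈ [0, 1]`. [folklore] -/
theorem cfgWeight_nonneg {p : ℝ} (hp0 : 0 ≤ p) (hp1 : p ≤ 1) (ω : Finset ι) :
    0 ≤ cfgWeight p ω :=
  prod_nonneg fun i _ => by split_ifs <;> linarith

/-- If `ω` agrees with `ω'` off `S`, then `P_p[ω] ≤ P_p[ω'] / min{p,1-p}^{|S|}` (each of the
`|S|` differing factors is at most `1 ≤ (factor of ω') / min{p,1-p}`).
[cite: DuminilCopinSidoraviciusTassion2016, Lemma 7 (proof, eq. (14))] -/
theorem cfgWeight_le_of_agree_off {p : ℝ} (hp0 : 0 < p) (hp1 : p < 1) {ω ω' S : Finset ι}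
    (h : ∀ i, i ∉ S → (i ∈ ω ↔ i ∈ ω')) :
    cfgWeight p ω ≤ cfgWeight p ω' / (min p (1 - p)) ^ S.card := by
  set m := min p (1 - p) with hm
  have hm0 : 0 < m := lt_min hp0 (by linarith)
  have hfac_le_one : ∀ (η : Finset ι) (i : ι), (if i ∈ η then p else 1 - p) ≤ 1 := by
    intro η i; split_ifs <;> linarith
  have hfac_nonneg : ∀ (η : Finset ι) (i : ι), 0 ≤ (if i ∈ η then p else 1 - p) := by
    intro η i; split_ifs <;> linarith
  have hfac_ge : ∀ (η : Finset ι) (i : ι), m ≤ (if i ∈ η then p else 1 - p) := by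
    intro η i; split_ifs
    · exact min_le_left _ _
    · exact min_le_right _ _
  -- split both products along `S` and `Sᶜ`
  have hsplit : ∀ η : Finset ι, cfgWeight p η =
      (∏ i ∈ S, if i ∈ η then p else 1 - p) * ∏ i ∈ Sᶜ, if i ∈ η then p else 1 - p := by
    intro η; unfold cfgWeight; rw [prod_mul_prod_compl]
  have hoff : (∏ i ∈ Sᶜ, if i ∈ ω then p else 1 - p) = ∏ i ∈ Sᶜ, if i ∈ ω' then p else 1 - p := by
    refine prod_congr rfl fun i hi => ?_
    rw [mem_compl] at hi
    simp only [h i hi]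
  have hS_le : (∏ i ∈ S, if i ∈ ω then p else 1 - p) ≤ 1 :=
    prod_le_one (fun i _ => hfac_nonneg ω i) fun i _ => hfac_le_one ω i
  have hS_ge : m ^ S.card ≤ ∏ i ∈ S, if i ∈ ω' then p else 1 - p := by
    calc m ^ S.card = ∏ _i ∈ S, m := by rw [prod_const]
      _ ≤ ∏ i ∈ S, if i ∈ ω' then p else 1 - p :=
        prod_le_prod (fun _ _ => hm0.le) fun i _ => hfac_ge ω' i
  have hC : 0 ≤ ∏ i ∈ Sᶜ, if i ∈ ω' then p else 1 - p :=
    prod_nonneg fun i _ => hfac_nonneg ω' i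
  rw [hsplit ω, hsplit ω', hoff, le_div_iff₀ (pow_pos hm0 _)]
  calc (∏ i ∈ S, if i ∈ ω then p else 1 - p) * (∏ i ∈ Sᶜ, if i ∈ ω' then p else 1 - p) *
        m ^ S.card
      ≤ 1 * (∏ i ∈ Sᶜ, if i ∈ ω' then p else 1 - p) *
        ∏ i ∈ S, if i ∈ ω' then p else 1 - p := by
        gcongr
    _ = (∏ i ∈ S, if i ∈ ω' then p else 1 - p) *
        ∏ i ∈ Sᶜ, if i ∈ ω' then p else 1 - p := by ring

omit [Fintype ι] in
/-- At most `2^{|S|}` configurations of a family agree with a given `ω'` off `S` (they are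
determined by their trace on `S`). [cite: DuminilCopinSidoraviciusTassion2016, Lemma 7 (proof, eq. (16))] -/
theorem card_filter_agree_off_le (A : Finset (Finset ι)) (ω' S : Finset ι) (P : Finset ι → Prop)
    [DecidablePred P] (hP : ∀ ω ∈ A, P ω → ∀ i, i ∉ S → (i ∈ ω ↔ i ∈ ω')) :
    (A.filter P).card ≤ 2 ^ S.card := by
  rw [← card_powerset]
  refine card_le_card_of_injOn (fun ω => ω ∩ S) (fun ω hω => ?_) ?_
  · simp only [coe_powerset, Set.mem_preimage, Set.mem_powerset_iff, coe_subset]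
    exact inter_subset_right
  · intro ω₁ h₁ ω₂ h₂ heq
    simp only [coe_filter, Set.mem_setOf_eq] at h₁ h₂
    have a₁ := hP ω₁ h₁.1 h₁.2
    have a₂ := hP ω₂ h₂.1 h₂.2
    ext i
    by_cases hi : i ∈ S
    · have := Finset.ext_iff.1 heq i
      simpa [mem_inter, hi] using this
    · rw [a₁ i hi, a₂ i hi]

/-! ## Lemma 7 -/

/-- PROVED — **DST 2016, Lemma 7 (multi-valued map principle)**, weighted-sum form on the finite
product space `{0,1}^ι`. Let `0 < p < 1`, `s ∈ ℕ`, `t > 0`, `𝒜, ℬ` finite families of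
configurations and `Φ : 𝒜 → 𝔓(ℬ)` with (i) `|Φ(ω)| ≥ t` for `ω ∈ 𝒜` and (ii) for every
`ω' ∈ ℬ` a set `S` of at most `s` coordinates such that
`{ω ∈ 𝒜 : ω' ∈ Φ(ω)} ⊆ {ω : ω|_{Sᶜ} = ω'|_{Sᶜ}}`. Then
`Σ_{ω ∈ 𝒜} P_p[ω] ≤ (2 / min{p,1-p})^s / t · Σ_{ω' ∈ ℬ} P_p[ω']`.
[cite: DuminilCopinSidoraviciusTassion2016, Lemma 7] -/
theorem DST2016_lemma7 {p : ℝ} (hp0 : 0 < p) (hp1 : p < 1) (s : ℕ) {t : ℝ} (ht : 0 < t)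
    (A B : Finset (Finset ι)) (Φ : Finset ι → Finset (Finset ι))
    (hΦB : ∀ ω ∈ A, Φ ω ⊆ B) (hΦt : ∀ ω ∈ A, t ≤ (Φ ω).card)
    (hΦs : ∀ ω' ∈ B, ∃ S : Finset ι, S.card ≤ s ∧
      ∀ ω ∈ A, ω' ∈ Φ ω → ∀ i, i ∉ S → (i ∈ ω ↔ i ∈ ω')) :
    ∑ ω ∈ A, cfgWeight p ω ≤ (2 / min p (1 - p)) ^ s / t * ∑ ω' ∈ B, cfgWeight p ω' := by
  classical
  set m := min p (1 - p) with hm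
  have hm0 : 0 < m := lt_min hp0 (by linarith)
  have hm1 : m ≤ 1 := (min_le_left _ _).trans hp1.le
  have hms : 0 < m ^ s := pow_pos hm0 s
  choose! S hS using hΦs
  -- (14): each `ω ∈ 𝒜` is bounded by the average over `Φ(ω)`
  have h14 : ∀ ω ∈ A, cfgWeight p ω ≤ (t * m ^ s)⁻¹ * ∑ ω' ∈ Φ ω, cfgWeight p ω' := by
    intro ω hω
    have hcard : t ≤ (Φ ω).card := hΦt ω hω
    have hcard0 : (0 : ℝ) < (Φ ω).card := ht.trans_le hcard
    -- each term: `w(ω) m^s ≤ w(ω')`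
    have hterm : ∀ ω' ∈ Φ ω, cfgWeight p ω * m ^ s ≤ cfgWeight p ω' := by
      intro ω' hω'
      have hB : ω' ∈ B := hΦB ω hω hω'
      obtain ⟨hSc, hSa⟩ := hS ω' hB
      have h1 := cfgWeight_le_of_agree_off hp0 hp1 (hSa ω hω hω')
      have h2 : m ^ s ≤ m ^ (S ω').card := pow_le_pow_of_le_one hm0.le hm1 hSc
      have hw' : 0 ≤ cfgWeight p ω' := cfgWeight_nonneg hp0.le hp1.le ω'
      rw [le_div_iff₀ (pow_pos hm0 _)] at h1
      calc cfgWeight p ω * m ^ s ≤ cfgWeight p ω * m ^ (S ω').card := by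
            gcongr; exact cfgWeight_nonneg hp0.le hp1.le ω
        _ ≤ cfgWeight p ω' := h1
    have hsum : (Φ ω).card * (cfgWeight p ω * m ^ s) ≤ ∑ ω' ∈ Φ ω, cfgWeight p ω' := by
      rw [← nsmul_eq_mul, ← sum_const]
      exact sum_le_sum hterm
    have hw : 0 ≤ cfgWeight p ω := cfgWeight_nonneg hp0.le hp1.le ω
    rw [le_inv_mul_iff₀ (mul_pos ht hms)]
    calc t * m ^ s * cfgWeight p ω = t * (cfgWeight p ω * m ^ s) := by ring
      _ ≤ (Φ ω).card * (cfgWeight p ω * m ^ s) := by gcongr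
      _ ≤ ∑ ω' ∈ Φ ω, cfgWeight p ω' := hsum
  -- (15): exchange the two summations
  have h15 : ∑ ω ∈ A, ∑ ω' ∈ Φ ω, cfgWeight p ω' =
      ∑ ω' ∈ B, ((A.filter fun ω => ω' ∈ Φ ω).card : ℝ) * cfgWeight p ω' := by
    have : ∀ ω ∈ A, ∑ ω' ∈ Φ ω, cfgWeight p ω' =
        ∑ ω' ∈ B, if ω' ∈ Φ ω then cfgWeight p ω' else 0 := by
      intro ω hω
      rw [sum_ite_mem, inter_eq_right.2 (hΦB ω hω)]
    rw [sum_congr rfl this, sum_comm]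
    refine sum_congr rfl fun ω' _ => ?_
    rw [← sum_filter, sum_const, nsmul_eq_mul]
  -- (16): at most `2^s` preimages
  have h16 : ∀ ω' ∈ B, ((A.filter fun ω => ω' ∈ Φ ω).card : ℝ) ≤ 2 ^ s := by
    intro ω' hω'
    obtain ⟨hSc, hSa⟩ := hS ω' hω'
    have := card_filter_agree_off_le A ω' (S ω') (fun ω => ω' ∈ Φ ω)
      (fun ω hω hP => hSa ω hω hP)
    calc ((A.filter fun ω => ω' ∈ Φ ω).card : ℝ) ≤ (2 : ℝ) ^ (S ω').card := by
          exact_mod_cast this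
      _ ≤ 2 ^ s := pow_le_pow_right₀ (by norm_num) hSc
  -- assemble
  calc ∑ ω ∈ A, cfgWeight p ω
      ≤ ∑ ω ∈ A, (t * m ^ s)⁻¹ * ∑ ω' ∈ Φ ω, cfgWeight p ω' := sum_le_sum h14
    _ = (t * m ^ s)⁻¹ * ∑ ω' ∈ B, ((A.filter fun ω => ω' ∈ Φ ω).card : ℝ) * cfgWeight p ω' := by
        rw [← mul_sum, h15]
    _ ≤ (t * m ^ s)⁻¹ * ∑ ω' ∈ B, 2 ^ s * cfgWeight p ω' := by
        gcongr with ω' hω'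
        · exact cfgWeight_nonneg hp0.le hp1.le ω'
        · exact h16 ω' hω'
    _ = (2 / m) ^ s / t * ∑ ω' ∈ B, cfgWeight p ω' := by
        rw [← mul_sum, div_pow]
        field_simp

/-! ## The measure form -/

omit [DecidableEq ι] in
/-- A singleton of the finite product space is the cylinder over all coordinates. [folklore] -/
theorem singleton_eq_localCylinder_univ (ω : Finset ι) :
    ({(↑ω : Set ι)} : Set (Set ι)) = localCylinder (↑(Finset.univ : Finset ι)) (↑ω : Set ι) := by
  ext ω'
  simp only [Set.mem_singleton_iff, localCylinder, coe_univ, Set.mem_univ, forall_const,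
    Set.mem_setOf_eq, mem_coe]
  constructor
  · rintro rfl i; simp
  · intro h; ext i; simpa using h i

/-- Under `setBer(univ, p)` on the finite product space `Set ι`, a single configuration `ω` has
probability `cfgWeight p ω = p^{|ω|}(1-p)^{|ι∖ω|}` (Russo 1981, §4, `μ_x = ∏ ν_{x_i}`).
[cite: RussoZW1981, §4 Lemma 3 (proof)] -/
theorem setBernoulli_real_singleton_coe (p : unitInterval) (ω : Finset ι) :
    (setBer((Set.univ : Set ι), p)).real {(↑ω : Set ι)} = cfgWeight p ω := by
  rw [singleton_eq_localCylinder_univ, Russo.setBernoulli_real_localCylinder]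
  unfold cfgWeight
  refine prod_congr rfl fun i _ => ?_
  simp [Russo.weight]

/-- The probability of a finite family of configurations is the sum of their weights.
[cite: DuminilCopinSidoraviciusTassion2016, Lemma 7 (proof, Σ_{ω ∈ 𝒜} P[ω])] -/
theorem setBernoulli_real_image_coe (p : unitInterval) (A : Finset (Finset ι)) :
    (setBer((Set.univ : Set ι), p)).real ((fun ω : Finset ι => (↑ω : Set ι)) '' ↑A) =
      ∑ ω ∈ A, cfgWeight p ω := by
  have himg : (fun ω : Finset ι => (↑ω : Set ι)) '' ↑A = ⋃ ω ∈ A, {(↑ω : Set ι)} := by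
    ext η; simp [eq_comm]
  rw [himg, measureReal_biUnion_finset]
  · exact sum_congr rfl fun ω _ => setBernoulli_real_singleton_coe p ω
  · intro ω₁ _ ω₂ _ hne
    exact Set.disjoint_singleton.2 fun h => hne (coe_injective h)
  · intro ω _
    rw [singleton_eq_localCylinder_univ]
    exact measurableSet_localCylinder (Set.toFinite _).countable _

/-- PROVED — **DST 2016, Lemma 7 (multi-valued map principle)** for the product Bernoulli
measure `P_p = setBer(univ, p)` on the finite product space `Set ι`, `0 < p < 1`: under
hypotheses (i)–(ii) of `DST2016_lemma7`,
`P_p[𝒜] ≤ (2 / min{p,1-p})^s / t · P_p[ℬ]`.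
[cite: DuminilCopinSidoraviciusTassion2016, Lemma 7] -/
theorem DST2016_lemma7_setBernoulli (p : unitInterval) (hp0 : 0 < (p : ℝ)) (hp1 : (p : ℝ) < 1)
    (s : ℕ) {t : ℝ} (ht : 0 < t) (A B : Finset (Finset ι)) (Φ : Finset ι → Finset (Finset ι))
    (hΦB : ∀ ω ∈ A, Φ ω ⊆ B) (hΦt : ∀ ω ∈ A, t ≤ (Φ ω).card)
    (hΦs : ∀ ω' ∈ B, ∃ S : Finset ι, S.card ≤ s ∧
      ∀ ω ∈ A, ω' ∈ Φ ω → ∀ i, i ∉ S → (i ∈ ω ↔ i ∈ ω')) :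
    (setBer((Set.univ : Set ι), p)).real ((fun ω : Finset ι => (↑ω : Set ι)) '' ↑A) ≤
      (2 / min (p : ℝ) (1 - p)) ^ s / t *
        (setBer((Set.univ : Set ι), p)).real ((fun ω : Finset ι => (↑ω : Set ι)) '' ↑B) := by
  rw [setBernoulli_real_image_coe, setBernoulli_real_image_coe]
  exact DST2016_lemma7 hp0 hp1 s ht A B Φ hΦB hΦt hΦs

end Literature.Probability.Percolation

end
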